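import Summits.QuantumFields.BalabanUV.T4Continuum.Support.NE9LinSizeEndCPiece

/-!
# NE9ChannelSum — crew row (w25) «THE CHANNEL-SUM ASSEMBLY»: the four channel-structure binders of the NE9 END are closed under
# the SUM of two channels on a common class; the PROFILE of a sum fades at the SLOWER of the two rates with the channel weights
# ADDED; and the d-currency END face E5′ at the assembled channel `T_a + T_b` (cell `pub-balaban`, T4-DAG §2 node U3 / §6 NE9;
# rung (B)+1 on a FIXED finite T⁴; NE9 formalisation crew, unit `b2b-balaban-t4-ne9-formalise-leaf-07` gen 5, CLAIMS.log l.10277;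
# row OWNER t4-ne9-p1-g25's l.10121: «(w25) the CHANNEL-SUM assembly (the frame's 𝒯 = species (a) ⊕ species (b))»; species-
# AGNOSTIC — no `RemData` / `CurData` / `KerData` inside; nothing of any import modified, no END re-wired)

HONEST FRAMING (T4-DAG PAGE 1).  Rung (B)+1 = existence and uniqueness of the ε → 0 limit of gauge-invariant observables on a
FIXED finite torus T⁴ — NOT infinite volume, NOT a mass gap, NOT the Clay problem.  NE9 is a cell NEW ESTIMATE, NOT PRINTED and
NOT discharged here («NE9 ⇐ the named binders»).  [I]/[II] locators are TYPE locators (ABSOLUTE RULE: nothing printed in the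
audited series is asserted); `FlowStep.BetaPertH`, (B), (B^μ) do not occur.  HONEST DEPENDENCY (verbatim): continuum YM on T⁴ ⇐
BetaPertH ∧ nine spine estimates (0/9 proved); BetaPertH ⇐ (D1) ∧ (D4) ∧ CAP+tail; G-an2-4 gates asym, D1 and NE2/3/4.

WHY.  The located correction O-ne9p1g25-1 (owner gen 25) types leaf S5 for TWO species families of [I] §§3–4 at form level:
species (a) — the fifth-order remainder of (3.34) along the Lemma-4 slice curves (`NE9Lemma1CurveSpecies`, gain ℓ⁵, rate letter
ω_a = L⁻¹ for the displayed count) — and species (b) — the point-localized terms of §4 (`NE9Lemma1KernelSpecies`, gains (L^jη)⁵ resp.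
(L^jη)^{4+β}, rate letter ω_b = L^{−β}, p. 288 «the power 4 + β instead of 5»; O-ne9p1g23-1).  The frame's history channel 𝒯
is their SUM: [II] p. 7 «It is a sum over all admissible □₀, Y₀, j and X», the (1.33) localization being performed term by term on
the whole expansion (3.34).  Each species delivers its own `ChannelSizeAtStepNN Adm (cpieceChannel ·) κ (weightOf frame κ₁ d₀ O1
Kp·) (tauOfG cQ· (agePow ω·))`; this file assembles them ON THE CHANNEL LEVEL (no common index algebra is forced on the two data).

WHAT IS PROVED (kernel; `[folklore]` bookkeeping + ONE END applied BY NAME; 0 `def`, 0 sorry).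
§1 **Closure of the S-binders under `T_a + T_b`** on a common class `Adm`: `channelAdditive_add`, `channelLocal_add`,
   `channelStepSum_add`, and **`channelSizeAtStepNN_add`**: per-step sizes `(wt_a, τ_a)`, `(wt_b, τ_b)` with `wt_a, wt_b ≤ wt`
   (a COMMON output weight — what R1's reading `hρ` and the box `hbox` consume) and `τ_a, τ_b ≥ 0` give
   `ChannelSizeAtStepNN Adm (T_a + T_b) κ wt (τ_a + τ_b)` (triangle inequality).
§2 **Letters.**  `weightOf_mono` / `weightOf_add`: the (1.29)/(1.36)-weight `weightOf frame κ₁ d₀ O1 Kp` is monotone and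
   additive in `Kp` — two species ON THE SAME OUTPUT FRAME share `wt := weightOf frame κ₁ d₀ O1 (Kp_a + Kp_b)`; `weightOf_frame_congr`:
   it reads the frame only through `d_k(Y)`.  **`profile_add`**: `τ_a k j ≤ τ̄_a·ω_a^{k−j}`, `τ_b k j ≤ τ̄_b·ω_b^{k−j}` ⟹
   `(τ_a + τ_b) k j ≤ (τ̄_a + τ̄_b)·(max ω_a ω_b)^{k−j}`; `profile_tauOfG_add`: the instance for `tauOfG cQ· (agePow ω·)`.  THIS IS THE
   HONEST CONTENT OF O-ne9p1g23-1 AT THE ASSEMBLY: the assembled channel fades at the SLOWER rate `max ω_a ω_b` (= L^{−β}), the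
   channel weights τ̄ ADD.
§3 **E5′-SUM `torus_termSize_ne9_and_fadingMemory_of_linSizeDischargers_sum`** = ROOT E5′ (`NE9LinSizeEnd.torus_termSize_ne9_and_
   fadingMemory_of_linSizeDischargers`, p209889) at `T := T_a + T_b` with `hadd`/`hsum`/`hstep`/`hτ` ASSEMBLED by §1–§2 from the two
   channels' binders displayed PER SUMMAND; `Factorises` / `LastCouplingLipschitz` at `T_a + T_b` (S4/(L), displayed as in every E5′
   face); `hpos` derived from `0 < ω_a`.  Conclusion = E5′'s root shape with rate letter
   **`μ = max ω_a ω_b + 4·lipbar·(a₁·e^{−a″(ν+1)})·(τ̄_a + τ̄_b)`**.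
§4 **`channelSizeAtStepNN_add_cpiece`**: the §1 weight condition DISCHARGED for two class-relative piece forms on the same output
   frame: `wt := weightOf P_a.frame κ₁ d₀ O1 (Kp_a + Kp_b)` dominates both species' weights (`P_b.dY = P_a.dY`, `Kp ≥ 0`, `O1 ≥ 0`).
DISGUISE TEST: one-history sizes of linear channels and their sum; the fading SOURCE, not NE9.  NOT claimed: that Bałaban's (1.33)
IS this sum with these letters (O-NE9-1), nor the species' own binders (displayed per summand).

References (TYPE locators only): T. Bałaban, CMP **109** (1987) [Balaban1987RG1] (0.29)–(0.30) p. 258, (1.18) p. 263, (3.34) p. 277,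
(4.18) p. 285, (4.22) p. 286, p. 288; CMP **116** (1988) [Balaban1988RG2Cluster] (1.23)–(1.29) pp. 7–8, (1.33)–(1.36) p. 9, (2.27)
p. 18, (2.38) p. 20, (2.41) p. 21; R. Kotecký, D. Preiss, CMP **103** (1986) [KoteckyPreiss1986].
-/

noncomputable section

namespace Summit.QuantumFields.BalabanUV.T4Continuum.NE9ChannelSum

open scoped BigOperators
open Metric Set MeasureTheory BoundedContinuousFunction
open Literature.Probability.LatticeModels
open Literature.MathematicalPhysics.QuantumFieldTheory
open Literature.MathematicalPhysics.QuantumFieldTheory.Balaban1983to89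
open Literature.MathematicalPhysics.QuantumFieldTheory.Balaban1983to89.T4OutputRate
open Literature.MathematicalPhysics.QuantumFieldTheory.Balaban1983to89.T4ActivityLipschitz
open Literature.MathematicalPhysics.QuantumFieldTheory.Balaban1983to89.T4HistoryLipschitzRecursion
open Literature.MathematicalPhysics.QuantumFieldTheory.Balaban1983to89.T4HistoryLipschitzOuter
open Literature.MathematicalPhysics.QuantumFieldTheory.Balaban1983to89.T4HistoryLipschitzActivity
open Literature.MathematicalPhysics.QuantumFieldTheory.Balaban1983to89.T4HistoryLipschitzEntropy
open Literature.MathematicalPhysics.QuantumFieldTheory.Balaban1983to89.T4HistoryLipschitzCubeGeometry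
open Literature.MathematicalPhysics.QuantumFieldTheory.Balaban1983to89.T4HistoryLipschitzActivity (ClusterGeom)
open Literature.MathematicalPhysics.QuantumFieldTheory.Balaban1983to89.T4HistoryLipschitzSegment
open Literature.MathematicalPhysics.QuantumFieldTheory.Balaban1983to89.T4HistoryLipschitzLinearSize
open Summit.QuantumFields.BalabanUV.T4Continuum.NE9Lemma1Counting
open Summit.QuantumFields.BalabanUV.T4Continuum.NE9Lemma1Gain
open Summit.QuantumFields.BalabanUV.T4Continuum.NE9Lemma1PieceClass
open Summit.QuantumFields.BalabanUV.T4Continuum.NE9LinSizeEnd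

/-! ## §1 The channel-structure binders are closed under the sum of two channels -/

section Sum

variable {C : Carriers} {Bg ι : Type} {Adm : Set (Bg → C.Dom → ℝ)}
  {T₁ T₂ : ℕ → (ℕ → ℝ) → (Bg → C.Dom → ℝ) → ι → ℝ}

/-- **S3 (additivity in the old terms) for a SUM of channels** on a common class. [cite: Balaban1988RG2Cluster, (1.33) p.9] -/
theorem channelAdditive_add (h₁ : ChannelAdditive Adm T₁) (h₂ : ChannelAdditive Adm T₂) : ChannelAdditive Adm (T₁ + T₂) := by
  intro k s H₁ hH₁ H₂ hH₂ y
  simp only [Pi.add_apply]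
  rw [h₁ k s H₁ hH₁ H₂ hH₂ y, h₂ k s H₁ hH₁ H₂ hH₂ y]
  ring

/-- **S-LOC for a SUM of channels**: both summands read only the terms created at steps ≤ k, hence so does the sum. [folklore] -/
theorem channelLocal_add (h₁ : ChannelLocal Adm T₁) (h₂ : ChannelLocal Adm T₂) : ChannelLocal Adm (T₁ + T₂) := by
  intro k s H hH y
  simp only [Pi.add_apply]
  rw [h₁ k s H hH y, h₂ k s H hH y]

/-- **S-SUM (step-sum) for a SUM of channels**: the creation-step decompositions add. [cite: Balaban1988RG2Cluster, (1.23) p.7, (1.33) p.9] -/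
theorem channelStepSum_add (h₁ : ChannelStepSum Adm T₁) (h₂ : ChannelStepSum Adm T₂) : ChannelStepSum Adm (T₁ + T₂) := by
  intro k s H hH y
  simp only [Pi.add_apply]
  rw [h₁ k s H hH y, h₂ k s H hH y, ← Finset.sum_add_distrib]

/-- **S5 (per-creation-step size) FOR A SUM OF CHANNELS — the assembly lemma.**  If `T₁` has per-step size `(wt₁, τ₁)` and `T₂`
has `(wt₂, τ₂)` on the class `Adm`, both weights are dominated by a COMMON output weight `wt` and both profiles are nonnegative,
then `T₁ + T₂` has per-step size `(wt, τ₁ + τ₂)`: |T₁ + T₂| ≤ wt₁τ₁N + wt₂τ₂N ≤ wt·(τ₁ + τ₂)·N.  (Print: the sum over «all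
admissible □₀, Y₀, j and X» of [II] p. 7 runs over every species of (3.34) at once; (1.36) is stated for the whole V′_k.)
[cite: Balaban1988RG2Cluster, (1.24) p.7, (1.29) p.8, (1.36) p.9] -/
theorem channelSizeAtStepNN_add {κ : ℝ} {wt wt₁ wt₂ : ℕ → ι → ℝ} {τ₁ τ₂ : ℕ → ℕ → ℝ}
    (h₁ : ChannelSizeAtStepNN Adm T₁ κ wt₁ τ₁) (h₂ : ChannelSizeAtStepNN Adm T₂ κ wt₂ τ₂)
    (hw₁ : ∀ k y, wt₁ k y ≤ wt k y) (hw₂ : ∀ k y, wt₂ k y ≤ wt k y)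
    (hτ₁ : ∀ k j, j ≤ k → 0 ≤ τ₁ k j) (hτ₂ : ∀ k j, j ≤ k → 0 ≤ τ₂ k j) :
    ChannelSizeAtStepNN Adm (T₁ + T₂) κ wt (τ₁ + τ₂) := by
  intro k j hjk s H hH hsupp N hN hbd y
  have e₁ := h₁ k j hjk s H hH hsupp N hN hbd y
  have e₂ := h₂ k j hjk s H hH hsupp N hN hbd y
  have hN₁ : 0 ≤ τ₁ k j * N := mul_nonneg (hτ₁ k j hjk) hN
  have hN₂ : 0 ≤ τ₂ k j * N := mul_nonneg (hτ₂ k j hjk) hN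
  simp only [Pi.add_apply]
  calc |T₁ k s H y + T₂ k s H y| ≤ |T₁ k s H y| + |T₂ k s H y| := abs_add_le _ _
    _ ≤ wt₁ k y * (τ₁ k j * N) + wt₂ k y * (τ₂ k j * N) := add_le_add e₁ e₂
    _ ≤ wt k y * (τ₁ k j * N) + wt k y * (τ₂ k j * N) :=
        add_le_add (mul_le_mul_of_nonneg_right (hw₁ k y) hN₁) (mul_le_mul_of_nonneg_right (hw₂ k y) hN₂)
    _ = wt k y * ((τ₁ k j + τ₂ k j) * N) := by ring

/-- All four S-binders of a sum at once (S3 + S-LOC + S-SUM + S5 with a common weight). [folklore] -/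
theorem sBinders_add {κ : ℝ} {wt wt₁ wt₂ : ℕ → ι → ℝ} {τ₁ τ₂ : ℕ → ℕ → ℝ}
    (ha₁ : ChannelAdditive Adm T₁) (hl₁ : ChannelLocal Adm T₁) (hs₁ : ChannelStepSum Adm T₁)
    (hz₁ : ChannelSizeAtStepNN Adm T₁ κ wt₁ τ₁)
    (ha₂ : ChannelAdditive Adm T₂) (hl₂ : ChannelLocal Adm T₂) (hs₂ : ChannelStepSum Adm T₂)
    (hz₂ : ChannelSizeAtStepNN Adm T₂ κ wt₂ τ₂)
    (hw₁ : ∀ k y, wt₁ k y ≤ wt k y) (hw₂ : ∀ k y, wt₂ k y ≤ wt k y)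
    (hτ₁ : ∀ k j, j ≤ k → 0 ≤ τ₁ k j) (hτ₂ : ∀ k j, j ≤ k → 0 ≤ τ₂ k j) :
    ChannelAdditive Adm (T₁ + T₂) ∧ ChannelLocal Adm (T₁ + T₂) ∧ ChannelStepSum Adm (T₁ + T₂) ∧
      ChannelSizeAtStepNN Adm (T₁ + T₂) κ wt (τ₁ + τ₂) :=
  ⟨channelAdditive_add ha₁ ha₂, channelLocal_add hl₁ hl₂, channelStepSum_add hs₁ hs₂,
    channelSizeAtStepNN_add hz₁ hz₂ hw₁ hw₂ hτ₁ hτ₂⟩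

end Sum

/-! ## §2 Letters: the output weight is monotone / additive in `Kp`; the profile of a sum fades at the slower rate -/

section Letters

variable {C : Carriers} {Bg ι α β γ : Type}

/-- The (1.29)/(1.36) output weight `weightOf frame κ₁ d₀ O1 Kp` is MONOTONE in the species constant `Kp` (for `O1 ≥ 0`). [folklore] -/
theorem weightOf_mono (P : PieceData C Bg ι α β γ) {κ₁ d0 O1 : ℝ} {Kp Kp' : ℕ → ι → ℝ} (hO1 : 0 ≤ O1)
    (h : ∀ k y, Kp k y ≤ Kp' k y) (k : ℕ) (y : ι) : weightOf P κ₁ d0 O1 Kp k y ≤ weightOf P κ₁ d0 O1 Kp' k y := by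
  simp only [weightOf]
  have hc : 0 ≤ O1 * Real.exp 1 * Real.exp ((1 / 8) * κ₁ * d0) * Real.exp (-(1 / 16) * κ₁ * P.dY k y) := by positivity
  calc Kp k y * O1 * Real.exp 1 * Real.exp ((1 / 8) * κ₁ * d0) * Real.exp (-(1 / 16) * κ₁ * P.dY k y)
      = Kp k y * (O1 * Real.exp 1 * Real.exp ((1 / 8) * κ₁ * d0) * Real.exp (-(1 / 16) * κ₁ * P.dY k y)) := by ring
    _ ≤ Kp' k y * (O1 * Real.exp 1 * Real.exp ((1 / 8) * κ₁ * d0) * Real.exp (-(1 / 16) * κ₁ * P.dY k y)) :=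
        mul_le_mul_of_nonneg_right (h k y) hc
    _ = Kp' k y * O1 * Real.exp 1 * Real.exp ((1 / 8) * κ₁ * d0) * Real.exp (-(1 / 16) * κ₁ * P.dY k y) := by ring

/-- The output weight is ADDITIVE in `Kp`: `weightOf … (Kp + Kp') = weightOf … Kp + weightOf … Kp'`. [folklore] -/
theorem weightOf_add (P : PieceData C Bg ι α β γ) (κ₁ d0 O1 : ℝ) (Kp Kp' : ℕ → ι → ℝ) (k : ℕ) (y : ι) :
    weightOf P κ₁ d0 O1 (Kp + Kp') k y = weightOf P κ₁ d0 O1 Kp k y + weightOf P κ₁ d0 O1 Kp' k y := by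
  simp only [weightOf, Pi.add_apply]
  ring

/-- The output weight reads the index frame ONLY through `d_k(Y)`: two frames with the same `dY` have the same weights. [folklore] -/
theorem weightOf_frame_congr {α' β' γ' : Type} (P : PieceData C Bg ι α β γ) (P' : PieceData C Bg ι α' β' γ')
    (hdY : P'.dY = P.dY) (κ₁ d0 O1 : ℝ) (Kp : ℕ → ι → ℝ) : weightOf P' κ₁ d0 O1 Kp = weightOf P κ₁ d0 O1 Kp := by
  funext k y
  simp only [weightOf, hdY]

/-- **THE PROFILE OF A SUM FADES AT THE SLOWER RATE, WITH THE WEIGHTS ADDED**: `τ_a k j ≤ τ̄_a·ω_a^{k−j}` and `τ_b k j ≤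
τ̄_b·ω_b^{k−j}` (both nonnegative, `τ̄·, ω· ≥ 0`) give `(τ_a + τ_b) k j ≤ (τ̄_a + τ̄_b)·(max ω_a ω_b)^{k−j}` — the END's `hτ` binder for
the sum.  Letters: ω_a = L⁻¹ (fifth-order species), ω_b = L^{−β} (the (4.30)-species, [I] p. 288), so `max = L^{−β}` (O-ne9p1g23-1).
[cite: Balaban1987RG1, (0.29)-(0.30) p.258, (4.18) p.285, p.288] -/
theorem profile_add {τ₁ τ₂ : ℕ → ℕ → ℝ} {τb₁ τb₂ ω₁ ω₂ : ℝ}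
    (h₁ : ∀ k j, j ≤ k → 0 ≤ τ₁ k j ∧ τ₁ k j ≤ τb₁ * ω₁ ^ (k - j))
    (h₂ : ∀ k j, j ≤ k → 0 ≤ τ₂ k j ∧ τ₂ k j ≤ τb₂ * ω₂ ^ (k - j))
    (hτb₁ : 0 ≤ τb₁) (hτb₂ : 0 ≤ τb₂) (hω₁ : 0 ≤ ω₁) (hω₂ : 0 ≤ ω₂) :
    ∀ k j, j ≤ k → 0 ≤ (τ₁ + τ₂) k j ∧ (τ₁ + τ₂) k j ≤ (τb₁ + τb₂) * (max ω₁ ω₂) ^ (k - j) := by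
  intro k j hjk
  obtain ⟨h1n, h1b⟩ := h₁ k j hjk
  obtain ⟨h2n, h2b⟩ := h₂ k j hjk
  have hp₁ : ω₁ ^ (k - j) ≤ (max ω₁ ω₂) ^ (k - j) := pow_le_pow_left₀ hω₁ (le_max_left _ _) _
  have hp₂ : ω₂ ^ (k - j) ≤ (max ω₁ ω₂) ^ (k - j) := pow_le_pow_left₀ hω₂ (le_max_right _ _) _
  simp only [Pi.add_apply]
  refine ⟨add_nonneg h1n h2n, ?_⟩
  calc τ₁ k j + τ₂ k j ≤ τb₁ * ω₁ ^ (k - j) + τb₂ * ω₂ ^ (k - j) := add_le_add h1b h2b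
    _ ≤ τb₁ * (max ω₁ ω₂) ^ (k - j) + τb₂ * (max ω₁ ω₂) ^ (k - j) :=
        add_le_add (mul_le_mul_of_nonneg_left hp₁ hτb₁) (mul_le_mul_of_nonneg_left hp₂ hτb₂)
    _ = (τb₁ + τb₂) * (max ω₁ ω₂) ^ (k - j) := by ring

/-- The `tauOfG`/`agePow` instance: two species with counts `c_Q·` and rate letters `ω·` (`NE9Lemma1Gain.profileG` each) give
the sum profile `(c_Qa + c_Qb)·(max ω_a ω_b)^{k−j}`. [cite: Balaban1988RG2Cluster, (1.26)-(1.29) p.8; Balaban1987RG1, (0.30) p.258] -/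
theorem profile_tauOfG_add {cQ₁ cQ₂ ω₁ ω₂ : ℝ} (hcQ₁ : 0 ≤ cQ₁) (hcQ₂ : 0 ≤ cQ₂) (hω₁ : 0 ≤ ω₁) (hω₂ : 0 ≤ ω₂) :
    ∀ k j, j ≤ k → 0 ≤ (tauOfG cQ₁ (agePow ω₁) + tauOfG cQ₂ (agePow ω₂)) k j ∧
      (tauOfG cQ₁ (agePow ω₁) + tauOfG cQ₂ (agePow ω₂)) k j ≤ (cQ₁ + cQ₂) * (max ω₁ ω₂) ^ (k - j) :=
  profile_add (fun k j hjk => ⟨mul_nonneg hcQ₁ (agePow_nonneg hω₁ k j), (profileG hcQ₁ hω₁).1 k j hjk⟩)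
    (fun k j hjk => ⟨mul_nonneg hcQ₂ (agePow_nonneg hω₂ k j), (profileG hcQ₂ hω₂).1 k j hjk⟩) hcQ₁ hcQ₂ hω₁ hω₂

end Letters

/-! ## §3 E5′-SUM: the d-currency END face at the assembled channel `T_a + T_b` -/

section EndFace

variable {ν N : ℕ} {C : Carriers} {D : ℕ}
variable {Bg : Type} {Sp : Type*} [TopologicalSpace Sp] [MeasurableSpace Sp] [OpensMeasurableSpace Sp] {F : Type*}
  [Fintype F] {Ω : Type*} [MeasurableSpace Ω]

/-- **E5′-SUM — NE9 ∧ FADING MEMORY ∧ TERM SIZE FOR THE ASSEMBLED CHANNEL `T_a + T_b` (kernel composition BY NAME).**  ROOT E5′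
(`NE9LinSizeEnd.torus_termSize_ne9_and_fadingMemory_of_linSizeDischargers`) at `T := T_a + T_b`, with `hadd`/`hsum`/`hstep`
ASSEMBLED (§1) from the two summands' S-binders — displayed PER SUMMAND exactly as the species producers deliver them
(`sBinders_cpieceG`, `channelSizeAtStepNN_cur`, `channelSizeAtStepNN_ker`, …) — under a COMMON output weight `wt ≥ wt_a, wt_b`
(§4 / `weightOf_mono`), and the profile `hτ` of the sum from the two profiles (§2): rate letter of the face
**`μ = max ω_a ω_b + 4·lipbar·(a₁·e^{−a″(ν+1)})·(τ̄_a + τ̄_b)`** — the assembled channel fades at the SLOWER of the two rates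
(O-ne9p1g23-1: `max(L⁻¹, L^{−β}) = L^{−β}`) with the channel weights ADDED.  `Factorises` / `LastCouplingLipschitz` are taken at
`T_a + T_b` (S4/(L), displayed as in every E5′ face); `hpos` derived from `0 < ω_a`; every activity / geometry / (A″) / (L‴)
binder of E5′ VERBATIM.  Nothing of [I]–[II] asserted; that Bałaban's (1.33) IS this sum is O-NE9-1, NOT claimed.
[cite: Balaban1987RG1, (0.29)-(0.30) p.258, (1.18) p.263, (3.34) p.277, p.288; Balaban1988RG2Cluster, (1.23)-(1.29) pp.7-8, (1.33)-(1.36) p.9, (2.27) p.18, (2.38) p.20, (2.41) p.21; KoteckyPreiss1986, (1)-(3)] -/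
theorem torus_termSize_ne9_and_fadingMemory_of_linSizeDischargers_sum (Γ : CubeChart C (Fin ν → ZMod N) (torusAdj ν N) D)
    {ι : Type} {E : Functional C Bg}
    {W : Set (ℕ → ℝ)} {Adm : Set (Bg → C.Dom → ℝ)} {Ta Tb : ℕ → (ℕ → ℝ) → (Bg → C.Dom → ℝ) → ι → ℝ}
    {Ψ : ℕ → ℝ → (ι → ℝ) → Bg → C.Dom → ℝ}
    {μ : ℕ → ℝ → Bg → Finset (Fin ν → ZMod N) → Measure Ω} {pre : ℕ → ℝ → Bg → Finset (Fin ν → ZMod N) → Ω → ℂ}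
    {c : ℕ → ℝ → Bg → Finset (Fin ν → ZMod N) → Ω → F → ℂ}
    {pt : ℕ → ℝ → Bg → Finset (Fin ν → ZMod N) → Ω → F → Sp} {β : ℕ → Sp → ℝ}
    {dom : ℕ → Finset (Fin ν → ZMod N) → F → Finset (Fin ν → ZMod N)}
    {lip ε' α4 : ℕ → ℝ} {a₁ a'' κ lipbar ℓ τba τbb ωa ωb a a' : ℝ} {wt wta wtb : ℕ → ι → ℝ} {τa τb : ℕ → ℕ → ℝ}
    {lam p₀ Nsz : ℕ → ℝ}
    (ρ : ℕ → (ι → ℝ) → (Sp →ᵇ ℂ))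
    (h0 : ScaleZeroFree E W) (hAdm : AdmissibleTerms E W Adm) (hres : AdmRestrict Adm)
    -- species (a): its channel's S-binders and profile (displayed per summand, as delivered by its producer)
    (hadda : ChannelAdditive Adm Ta) (hsuma : ChannelStepSum Adm Ta) (hstepa : ChannelSizeAtStepNN Adm Ta κ wta τa)
    (hτa : ∀ k j, j ≤ k → 0 ≤ τa k j ∧ τa k j ≤ τba * ωa ^ (k - j)) (hτba : 0 ≤ τba) (hωa : 0 < ωa)
    -- species (b): likewise
    (haddb : ChannelAdditive Adm Tb) (hsumb : ChannelStepSum Adm Tb) (hstepb : ChannelSizeAtStepNN Adm Tb κ wtb τb)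
    (hτb : ∀ k j, j ≤ k → 0 ≤ τb k j ∧ τb k j ≤ τbb * ωb ^ (k - j)) (hτbb : 0 ≤ τbb) (hωb : 0 ≤ ωb)
    -- the COMMON output weight dominating both species' weights
    (hwa : ∀ k y, wta k y ≤ wt k y) (hwb : ∀ k y, wtb k y ≤ wt k y)
    -- S4 / (L) and R1 at the assembled channel (displayed, as in every E5′ face)
    (hfac : Factorises E W (Ta + Tb) Ψ) (hlast : LastCouplingLipschitz E W (Ta + Tb) Ψ κ lam)
    (hρ : ∀ (k : ℕ) (P P' : ι → ℝ) (M : ℝ), (∀ y, |P y - P' y| ≤ wt k y * M) → ‖ρ k P - ρ k P'‖ ≤ M)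
    (hΨ : ∀ (k : ℕ) (s : ℝ) (P P' : ι → ℝ) (U : Bg) (X : C.Dom),
      Ψ k s P U X - Ψ k s P' U X =
        (Γ.geom.newTerm (Γ.geom.avgExpLinearAct μ pre fun k s U γ ω => evalFunctional (c k s U γ ω) (pt k s U γ ω))
            k s U X (ρ k P) -
          Γ.geom.newTerm (Γ.geom.avgExpLinearAct μ pre fun k s U γ ω => evalFunctional (c k s U γ ω) (pt k s U γ ω))
            k s U X (ρ k P')).re)
    (hexpl : ∀ g ∈ W, ∀ (k : ℕ) (P : ι → ℝ) (U : Bg) (X : C.Dom), C.scale X = k + 1 →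
      |Ψ k (g k) P U X -
          (Γ.geom.newTerm (Γ.geom.avgExpLinearAct μ pre fun k s U γ ω => evalFunctional (c k s U γ ω) (pt k s U γ ω))
            k (g k) U X (ρ k P)).re| ≤ Real.exp (-(κ * C.d X)) * p₀ k)
    (hbase : ∀ g ∈ W, ∀ (U : Bg) (X : C.Dom), C.scale X = 0 → |E g U X| ≤ Real.exp (-(κ * C.d X)) * Nsz 0)
    (hNsucc : ∀ j, p₀ j + a₁ * Real.exp (-(a'' * (ν + 1))) ≤ Nsz (j + 1)) (hNnn : ∀ j, 0 ≤ Nsz j)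
    (hbox : ∀ (k : ℕ) (P : ι → ℝ), (∀ y, |P y| ≤ wt k y * sizeRadius (τa + τb) Nsz k) → ∀ x, ‖ρ k P x‖ ≤ β k x)
    -- activity side (verbatim E5′)
    (hpre : ∀ k s U γ, AEStronglyMeasurable (pre k s U γ) (μ k s U γ))
    (hc : ∀ k s U γ Y, AEStronglyMeasurable (fun ω => c k s U γ ω Y) (μ k s U γ))
    (hpt : ∀ k s U γ Y, Measurable fun ω => pt k s U γ ω Y) (hlip : ∀ k, 0 < lip k) (hlipb : ∀ k, lip k ≤ lipbar)
    (hint₀ : ∀ k s U γ, Integrable (fun ω => ‖pre k s U γ ω‖ * Real.exp (boxExponent c pt β k s U γ ω)) (μ k s U γ))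
    (hmeet : ∀ k s U (γ : Finset (Fin ν → ZMod N)) ω Y, c k s U γ ω Y ≠ 0 → ∃ x ∈ γ, x ∈ dom k γ Y)
    (hα4 : ∀ k, 0 ≤ α4 k) (ha : (2:ℝ) ^ ν * Real.log 2 + Real.log (8 * ν) ≤ a)
    (hliplb : ∀ k, α4 k * 2 ^ (ν + 1 + 2 ^ ν) ≤ lip k)
    (hlin : ∀ k s U (γ : Finset (Fin ν → ZMod N)) ω Y,
      ‖c k s U γ ω Y‖ ≤ α4 k * Real.exp (-(a * (linSize (dom k γ Y) : ℝ))))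
    (hdomconn : ∀ k (γ : Finset (Fin ν → ZMod N)) Y, (dom k γ Y).Nonempty →
      ∃ b ∈ dom k γ Y, Polymer.IsConn (torusAdj ν N) (dom k γ Y) b)
    (hdominj : ∀ k (γ : Finset (Fin ν → ZMod N)), Set.InjOn (dom k γ) {Y | (dom k γ Y).Nonempty})
    (hXconn : ∀ X, ∃ b, Polymer.IsConn (torusAdj ν N) (Γ.cubes X) b)
    (hcmp : ∀ X, κ * C.d X ≤ a'' * (linSize (Γ.cubes X) : ℝ))
    (hε' : ∀ k, 0 ≤ ε' k)
    (hdecayLin : ∀ g ∈ W, ∀ (k : ℕ) (U : Bg) (X : C.Dom), C.scale X = k + 1 → ∀ γ' ∈ Γ.vol X,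
      ∫ ω, ‖pre k (g k) U γ' ω‖ * Real.exp (boxExponent c pt β k (g k) U γ' ω) ∂(μ k (g k) U γ') ≤
        ε' k * Real.exp (-(a' * (linSize γ' : ℝ))))
    (ha₁ : 0 ≤ a₁) (ha'' : 0 ≤ a'')
    (hrate : (2:ℝ) ^ ν * Real.log 2 + Real.log (8 * ν) ≤ a' - a'' - 2 ^ ν * (a₁ + Real.log 2))
    (hsmall : ∀ k, ((D : ℝ) + 1) * (2 * ε' k) * Real.exp (a'' * (ν + 1) + 2 ^ ν * (a₁ + Real.log 2)) *
      2 ^ (ν + 1 + 2 ^ ν) ≤ a₁)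
    (hℓ : 0 ≤ ℓ) (hlam : ∀ k, lam k ≤ ℓ) :
    TermSize E W κ Nsz ∧
      NE9 E W κ (prodModuli ℓ fun _ => max ωa ωb + 4 * lipbar * (a₁ * Real.exp (-(a'' * (ν + 1)))) * (τba + τbb)) ∧
        FadingMemory (ℓ / (max ωa ωb + 4 * lipbar * (a₁ * Real.exp (-(a'' * (ν + 1)))) * (τba + τbb)))
          (max ωa ωb + 4 * lipbar * (a₁ * Real.exp (-(a'' * (ν + 1)))) * (τba + τbb))
          (prodModuli ℓ fun _ => max ωa ωb + 4 * lipbar * (a₁ * Real.exp (-(a'' * (ν + 1)))) * (τba + τbb)) := by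
  -- the assembled S-binders (§1) and profile (§2)
  have hadd := channelAdditive_add hadda haddb
  have hsum := channelStepSum_add hsuma hsumb
  have hstep := channelSizeAtStepNN_add hstepa hstepb hwa hwb (fun k j hjk => (hτa k j hjk).1) (fun k j hjk => (hτb k j hjk).1)
  have hτ := profile_add hτa hτb hτba hτbb hωa.le hωb
  -- envelope letters: ω := max ω_a ω_b > 0, τ̄ := τ̄_a + τ̄_b ≥ 0, hence hpos
  have hω : 0 ≤ max ωa ωb := hωa.le.trans (le_max_left _ _)
  have hτbar : 0 ≤ τba + τbb := add_nonneg hτba hτbb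
  have hlipbar : 0 ≤ lipbar := (hlip 0).le.trans (hlipb 0)
  have hpos : 0 < max ωa ωb + 4 * lipbar * (a₁ * Real.exp (-(a'' * (ν + 1)))) * (τba + τbb) := by
    have h2 : 0 ≤ 4 * lipbar * (a₁ * Real.exp (-(a'' * (ν + 1)))) * (τba + τbb) := by positivity
    have h3 : 0 < max ωa ωb := hωa.trans_le (le_max_left _ _)
    linarith
  exact torus_termSize_ne9_and_fadingMemory_of_linSizeDischargers Γ ρ h0 hAdm hres hadd hsum hstep hfac hlast hρ hΨ hexpl hbase
    hNsucc hNnn hbox hpre hc hpt hlip hlipb hint₀ hmeet hα4 ha hliplb hlin hdomconn hdominj hXconn hcmp hε' hdecayLin ha₁ ha''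
    hrate hsmall hℓ hτbar hω hpos hlam hτ

end EndFace

/-! ## §4 The weight condition DISCHARGED for two class-relative piece forms on the same output frame -/

section TwoSpecies

variable {C : Carriers} {Bg ι αa βa γa αb βb γb : Type}

/-- **TWO SPECIES ON THE SAME OUTPUT FRAME**: for class-relative piece forms `Pa`, `Pb` with the SAME `d_k(Y)` (`Pb.dY = Pa.dY` —
both are Bałaban's d_k(Y) of the output index; an identification binder), S5 for each (as delivered by `channelSizeAtStepNN_cpieceG`
/ `_cur` / `_ker`) assembles to S5 for `cpieceChannel Pa + cpieceChannel Pb` with the COMMON weight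
`weightOf Pa.frame κ₁ d₀ O1 (Kpa + Kpb)` and the summed profile — `Kp· ≥ 0`, `O1 ≥ 0`, profiles nonnegative.
[cite: Balaban1988RG2Cluster, (1.29) p.8, (1.36) p.9] -/
theorem channelSizeAtStepNN_add_cpiece {Adm : Set (Bg → C.Dom → ℝ)} (Pa : CPieceData C Bg ι αa βa γa)
    (Pb : CPieceData C Bg ι αb βb γb) {κ κ₁ d0 O1 : ℝ} {Kpa Kpb : ℕ → ι → ℝ} {τa τb : ℕ → ℕ → ℝ}
    (hdY : Pb.frame.dY = Pa.frame.dY)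
    (ha : ChannelSizeAtStepNN Adm (cpieceChannel Pa) κ (weightOf Pa.frame κ₁ d0 O1 Kpa) τa)
    (hb : ChannelSizeAtStepNN Adm (cpieceChannel Pb) κ (weightOf Pb.frame κ₁ d0 O1 Kpb) τb)
    (hKpa : ∀ k y, 0 ≤ Kpa k y) (hKpb : ∀ k y, 0 ≤ Kpb k y) (hO1 : 0 ≤ O1)
    (hτa : ∀ k j, j ≤ k → 0 ≤ τa k j) (hτb : ∀ k j, j ≤ k → 0 ≤ τb k j) :
    ChannelSizeAtStepNN Adm (cpieceChannel Pa + cpieceChannel Pb) κ (weightOf Pa.frame κ₁ d0 O1 (Kpa + Kpb)) (τa + τb) := by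
  refine channelSizeAtStepNN_add ha hb (fun k y => ?_) (fun k y => ?_) hτa hτb
  · exact weightOf_mono Pa.frame hO1 (fun k y => le_add_of_nonneg_right (hKpb k y)) k y
  · rw [weightOf_frame_congr Pa.frame Pb.frame hdY]
    exact weightOf_mono Pa.frame hO1 (fun k y => le_add_of_nonneg_left (hKpa k y)) k y

end TwoSpecies

/-! ## §5 (v1.1) THE ROW OWNER'S RESCALING ROAD — statements and proofs = t4-ne9-p1-g25's p214272 (frozen
`HOME/t4/b2b-balaban-t4-ne9-p1/g25/NE9ChannelSum.v1.lean`), re-homed here after the path crossing recorded in CLAIMS.log l.10379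
(its `profile_add`'s unused `hω` dropped); ONE rate, exact weights — complementary to §1–§2's two-rate `max` form. -/

section OwnerRescale

variable {C : Carriers} {Bg ι : Type}

/-- The pointwise sum of two channels, named (row owner's `addChannel`; definitionally the Pi-sum `T₁ + T₂` of §1–§4). [folklore] -/
def addChannel (T₁ T₂ : ℕ → (ℕ → ℝ) → (Bg → C.Dom → ℝ) → ι → ℝ) : ℕ → (ℕ → ℝ) → (Bg → C.Dom → ℝ) → ι → ℝ :=
  fun k s H y => T₁ k s H y + T₂ k s H y
/-- `addChannel` unfolds pointwise. [folklore] -/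
@[simp] theorem addChannel_apply (T₁ T₂ : ℕ → (ℕ → ℝ) → (Bg → C.Dom → ℝ) → ι → ℝ) (k : ℕ) (s : ℕ → ℝ)
    (H : Bg → C.Dom → ℝ) (y : ι) : addChannel T₁ T₂ k s H y = T₁ k s H y + T₂ k s H y := rfl

/-- **RESCALING** (row owner's `channelSizeAtStepNN_rescale`, p214272): a y-free factor of the weight moves into the per-creation-step
profile — `wt k y = c k·w k y` ⟹ weight `w`, profile `c k·τ k j` (`weightOf … Kp` has `Kp k y` y-free). [cite: Balaban1988RG2Cluster, (1.36) p.9] -/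
theorem channelSizeAtStepNN_rescale {Adm : Set (Bg → C.Dom → ℝ)} {T : ℕ → (ℕ → ℝ) → (Bg → C.Dom → ℝ) → ι → ℝ}
    {κ : ℝ} {w : ℕ → ι → ℝ} {c : ℕ → ℝ} {τ : ℕ → ℕ → ℝ}
    (h : ChannelSizeAtStepNN Adm T κ (fun k y => c k * w k y) τ) :
    ChannelSizeAtStepNN Adm T κ w (fun k j => c k * τ k j) :=
  fun k j hjk s H hH hsupp N hN hbd y => (h k j hjk s H hH hsupp N hN hbd y).trans_eq (by ring)

/-- **S5 FOR A SUM AT A COMMON WEIGHT — profiles add, no slack** (row owner's `channelSizeAtStepNN_add`, p214272; renamed — §1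
holds that name for the dominated-weights form). [cite: Balaban1988RG2Cluster, (1.33) p.9, (1.36) p.9] -/
theorem channelSizeAtStepNN_add_common {Adm : Set (Bg → C.Dom → ℝ)} {T₁ T₂ : ℕ → (ℕ → ℝ) → (Bg → C.Dom → ℝ) → ι → ℝ}
    {κ : ℝ} {w : ℕ → ι → ℝ} {τ₁ τ₂ : ℕ → ℕ → ℝ}
    (h₁ : ChannelSizeAtStepNN Adm T₁ κ w τ₁) (h₂ : ChannelSizeAtStepNN Adm T₂ κ w τ₂) :
    ChannelSizeAtStepNN Adm (addChannel T₁ T₂) κ w (fun k j => τ₁ k j + τ₂ k j) :=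
  fun k j hjk s H hH hsupp N hN hbd y => (abs_add_le (T₁ k s H y) (T₂ k s H y)).trans
    ((add_le_add (h₁ k j hjk s H hH hsupp N hN hbd y) (h₂ k j hjk s H hH hsupp N hN hbd y)).trans_eq (by ring))

/-- **S5 FOR THE SUM OF TWO SPECIES' CHANNELS WITH RESCALED WEIGHTS** (row owner's `channelSizeAtStepNN_add_rescaled`, p214272):
weights `c₁ k·w k y`, `c₂ k·w k y` on a common y-profile `w` (species: `w k y = O1·e·e^{κ₁d₀/8}·e^{−κ₁d_k(Y)/16}`, `c_i k = Kp_i k`)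
⟹ weight `w`, profile `c₁ k·τ₁ k j + c₂ k·τ₂ k j`. [cite: Balaban1988RG2Cluster, (1.33) p.9] -/
theorem channelSizeAtStepNN_add_rescaled {Adm : Set (Bg → C.Dom → ℝ)}
    {T₁ T₂ : ℕ → (ℕ → ℝ) → (Bg → C.Dom → ℝ) → ι → ℝ} {κ : ℝ} {w : ℕ → ι → ℝ} {c₁ c₂ : ℕ → ℝ} {τ₁ τ₂ : ℕ → ℕ → ℝ}
    (h₁ : ChannelSizeAtStepNN Adm T₁ κ (fun k y => c₁ k * w k y) τ₁)
    (h₂ : ChannelSizeAtStepNN Adm T₂ κ (fun k y => c₂ k * w k y) τ₂) :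
    ChannelSizeAtStepNN Adm (addChannel T₁ T₂) κ w (fun k j => c₁ k * τ₁ k j + c₂ k * τ₂ k j) :=
  channelSizeAtStepNN_add_common (channelSizeAtStepNN_rescale h₁) (channelSizeAtStepNN_rescale h₂)

/-- **THE ADDED RESCALED PROFILE IS GEOMETRIC AT ONE RATE** (row owner's `profile_add`, p214272; renamed — §2 holds that name for
the two-rate form): `c₁ k·τ₁ k j + c₂ k·τ₂ k j ≤ (c̄₁τ̄₁ + c̄₂τ̄₂)·ω^{k−j}`. [cite: Balaban1987RG1, (0.29)-(0.30) p.258] -/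
theorem profile_add_rescaled {c₁ c₂ : ℕ → ℝ} {τ₁ τ₂ : ℕ → ℕ → ℝ} {cb₁ cb₂ tb₁ tb₂ ω : ℝ}
    (hτ₁ : ∀ k j, j ≤ k → 0 ≤ τ₁ k j ∧ τ₁ k j ≤ tb₁ * ω ^ (k - j))
    (hτ₂ : ∀ k j, j ≤ k → 0 ≤ τ₂ k j ∧ τ₂ k j ≤ tb₂ * ω ^ (k - j))
    (hc₁ : ∀ k, 0 ≤ c₁ k ∧ c₁ k ≤ cb₁) (hc₂ : ∀ k, 0 ≤ c₂ k ∧ c₂ k ≤ cb₂) :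
    ∀ k j, j ≤ k → 0 ≤ c₁ k * τ₁ k j + c₂ k * τ₂ k j ∧
      c₁ k * τ₁ k j + c₂ k * τ₂ k j ≤ (cb₁ * tb₁ + cb₂ * tb₂) * ω ^ (k - j) := by
  intro k j hjk
  obtain ⟨h10, h11⟩ := hτ₁ k j hjk; obtain ⟨h20, h21⟩ := hτ₂ k j hjk; obtain ⟨hc10, hc11⟩ := hc₁ k; obtain ⟨hc20, hc21⟩ := hc₂ k
  refine ⟨add_nonneg (mul_nonneg hc10 h10) (mul_nonneg hc20 h20), ?_⟩
  calc c₁ k * τ₁ k j + c₂ k * τ₂ k j ≤ c₁ k * (tb₁ * ω ^ (k - j)) + c₂ k * (tb₂ * ω ^ (k - j)) :=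
        add_le_add (mul_le_mul_of_nonneg_left h11 hc10) (mul_le_mul_of_nonneg_left h21 hc20)
    _ ≤ cb₁ * (tb₁ * ω ^ (k - j)) + cb₂ * (tb₂ * ω ^ (k - j)) :=
        add_le_add (mul_le_mul_of_nonneg_right hc11 (h10.trans h11)) (mul_le_mul_of_nonneg_right hc21 (h20.trans h21))
    _ = (cb₁ * tb₁ + cb₂ * tb₂) * ω ^ (k - j) := by ring

/-- The S-binders of `addChannel T₁ T₂` in the rescaled form (row owner's `sBinders_add`, p214272; renamed). [folklore] -/
theorem sBinders_add_rescaled {Adm : Set (Bg → C.Dom → ℝ)} {T₁ T₂ : ℕ → (ℕ → ℝ) → (Bg → C.Dom → ℝ) → ι → ℝ} {κ : ℝ}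
    {w : ℕ → ι → ℝ} {c₁ c₂ : ℕ → ℝ} {τ₁ τ₂ : ℕ → ℕ → ℝ}
    (hA₁ : ChannelAdditive Adm T₁) (hA₂ : ChannelAdditive Adm T₂) (hS₁ : ChannelStepSum Adm T₁) (hS₂ : ChannelStepSum Adm T₂)
    (h₁ : ChannelSizeAtStepNN Adm T₁ κ (fun k y => c₁ k * w k y) τ₁)
    (h₂ : ChannelSizeAtStepNN Adm T₂ κ (fun k y => c₂ k * w k y) τ₂) :
    ChannelAdditive Adm (addChannel T₁ T₂) ∧ ChannelStepSum Adm (addChannel T₁ T₂) ∧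
      ChannelSizeAtStepNN Adm (addChannel T₁ T₂) κ w (fun k j => c₁ k * τ₁ k j + c₂ k * τ₂ k j) :=
  ⟨channelAdditive_add hA₁ hA₂, channelStepSum_add hS₁ hS₂, channelSizeAtStepNN_add_rescaled h₁ h₂⟩

end OwnerRescale

end Summit.QuantumFields.BalabanUV.T4Continuum.NE9ChannelSum

end
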